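import Summits.HubbardSuperconductivity.HubbardSuperconductivity.Theorems.AnisotropyChordSpinMonotoneTwoMagnonRookEigen
import Summits.HubbardSuperconductivity.HubbardSuperconductivity.Theorems.AnisotropyChordSpinMonotoneTwoMagnonRookOverlap
import Summits.HubbardSuperconductivity.HubbardSuperconductivity.Theorems.AnisotropyChordSpinMonotoneTwoMagnonEdgeTransitive

/-!
# Route `AnisotropyChord`: the TWO-MAGNON RUNG of `U_vt` (TM-VT) PROVED on every rook graph
# `K_m □ K_n` — the first family with TWO contact orbits (vertex- but not edge-transitive)

**Theorem** (`rook_twoMagnon_condensate_monotone`).  Let `G` be the rook graph on `α × β`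
(`(a,b) ∼ (a',b')` iff the sites agree in exactly one coordinate; `|α|, |β| ≥ 2`), i.e.
`K_{|α|} □ K_{|β|}`.  In the two-magnon sector `S^z_tot = |V|/2 − 2` of
`H(Δ) = xxzHamiltonian 1 G (−1) Δ`, for ALL `Δ₁ ≤ Δ₂ ≤ 1` and normalised sector ground states `ψ₁`
of `H(Δ₁)`, `ψ₂` of `H(Δ₂)`: `Λ(ψ₁) ≤ Λ(ψ₂)`, `Λ(ψ) = Re⟨ψ, S⁺_tot S⁻_tot ψ⟩`.  Hence the typed rung
`TwoMagnonVTCondensateMonotone` of `…SpinMonotoneDefs` holds on this family (`twoMagnonVT_of_rook`,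
`boxProdTop_twoMagnon_condensate_monotone`).  For `|α| ≠ |β|` the rook graph is vertex-transitive
but NOT edge-transitive (row edges and column edges are two `Aut`-orbits;
`rook_not_isEdgeTransitive`, file `…TwoMagnonRookOrbits`), so this is the first
instance of the rung beyond the one-contact-orbit theorem `twoMagnon_condensate_monotone_of_
edgeTransitive`; and, as there, NO lower bound on `Δ₁` is needed (contrast: on the two-ring tori
the theory seat found the window to close for `Δ < −2.7`).

Proof (exact solution; theory seat `hubbard-h0-rotor-theory-1`, cycle 5, rook family, here in
the unweighted case where it collapses to one parameter).  Perron–Frobenius makes the sector ground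
state a positive multiple of an `Aut`-invariant nonnegative vector `χ`, constant on the three pair
classes (`…TwoMagnonRookGraph`): values `a, b, c ≥ 0`, `c > 0`.  The eigen-equation in pair
coordinates is a `3 × 3` system (`rook_eigen_relations`, `…TwoMagnonRookEigen`) whose positive
solutions are `a/c = q/(q+t)`, `b/c = p/(p+t)` with `1 − Δ = t(1 + 1/(p+t) + 1/(q+t))`, `t ≥ 0`
(`rook_t_param`; `p = |α| − 1`, `q = |β| − 1`).  Then `|⟨φ, ψ⟩|² = (N/2)·p q·Nu(t)²/De(t)`
(`rook_flatOverlap_sq`), the anisotropy determines `t` monotonically and `Nu²/De` is non-increasing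
(`…TwoMagnonRookOverlap`), and `Λ = (4/N)|⟨φ,ψ⟩|² + (N − 4)` on invariant vectors
(`condensate_eq_flatOverlap`).  H. Tasaki, *Physics and Mathematics of Quantum Many-Body Systems*
(2020) §2.4, App. A.  No definition is introduced.
-/

set_option linter.dupNamespace false

noncomputable section

namespace Summit.HubbardSuperconductivity.HubbardSuperconductivity.Theorems.AnisotropyChord.TwoMagnon

open Matrix Complex Finset
open Literature.MathematicalPhysics.QuantumLattice
open Literature.Combinatorics.SimpleGraph (IsVertexTransitive)
open Literature.Combinatorics.SimpleGraph.RankThreeStronglyRegular (isRegularOfDegree_of_isVertexTransitive)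
open Summit.HubbardSuperconductivity.HubbardSuperconductivity.Theorems.PolyaSchurPairBoson (xxz_sector_perronFrobenius)

variable {α β : Type*} [Fintype α] [DecidableEq α] [Fintype β] [DecidableEq β]

/-- A self inner product `⟨χ, χ⟩` is real. [folklore] -/
theorem star_dotProduct_self_eq_re {ι : Type*} [Fintype ι] (χ : ι → ℂ) :
    star χ ⬝ᵥ χ = (((star χ ⬝ᵥ χ).re : ℝ) : ℂ) := by
  apply Complex.ext
  · rw [Complex.ofReal_re]
  · rw [Complex.ofReal_im, dotProduct, Complex.im_sum]
    refine Finset.sum_eq_zero fun σ _ => ?_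
    rw [Pi.star_apply, Complex.star_def, Complex.conj_mul', ← Complex.ofReal_pow, Complex.ofReal_im]

/-- **Positive solutions of the rook two-magnon problem are the exact one-parameter family.**  For a
nonzero entrywise-nonnegative real two-magnon sector ground vector `χ` of `H(Δ)`, `Δ ≤ 1`, on the
rook graph: `χ` takes real values `a, b ≥ 0`, `c > 0` on row, column and far pairs, and for some
`t ≥ 0`: `(q+t) a = q c`, `(p+t) b = p c`, `1 − Δ = t(1 + 1/(p+t) + 1/(q+t))`
(`p = |α| − 1`, `q = |β| − 1`). [folklore] -/
theorem rook_positive_solution (G : SimpleGraph (α × β)) [DecidableRel G.Adj]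
    (hadj : ∀ x y : α × β, G.Adj x y ↔ (x.1 ≠ y.1 ∧ x.2 = y.2) ∨ (x.1 = y.1 ∧ x.2 ≠ y.2))
    {a₀ a₁ : α} (hα : a₀ ≠ a₁) {b₀ b₁ : β} (hβ : b₀ ≠ b₁)
    {Δ : ℝ} (hΔ : Δ ≤ 1) {χ : (α × β → Fin 2) → ℂ}
    (hχK : χ ∈ spinZSector (Λ := α × β) 1 ((Fintype.card (α × β) : ℝ) / 2 - 2)) (hχ0 : χ ≠ 0)
    (hχnn : ∀ σ, 0 ≤ (χ σ).re ∧ (χ σ).im = 0)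
    (hχH : xxzHamiltonian 1 G (-1) Δ *ᵥ χ =
      ((lowestEnergyInSector 1 (xxzHamiltonian 1 G (-1) Δ) ((Fintype.card (α × β) : ℝ) / 2 - 2) : ℝ) : ℂ) • χ)
    (p q : ℝ) (hp : p = (Fintype.card α : ℝ) - 1) (hq : q = (Fintype.card β : ℝ) - 1) :
    ∃ a b cc t : ℝ, 0 ≤ a ∧ 0 ≤ b ∧ 0 < cc ∧ 0 ≤ t ∧
      (∀ x y : α × β, x.1 ≠ y.1 → x.2 = y.2 → χ (Pi.single x 1 + Pi.single y 1) = (a : ℂ)) ∧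
      (∀ x y : α × β, x.1 = y.1 → x.2 ≠ y.2 → χ (Pi.single x 1 + Pi.single y 1) = (b : ℂ)) ∧
      (∀ x y : α × β, x.1 ≠ y.1 → x.2 ≠ y.2 → χ (Pi.single x 1 + Pi.single y 1) = (cc : ℂ)) ∧
      (q + t) * a = q * cc ∧ (p + t) * b = p * cc ∧
      1 - Δ = t * (1 + 1 / (p + t) + 1 / (q + t)) := by
  haveI : Nonempty α := ⟨a₀⟩
  haveI : Nonempty β := ⟨b₀⟩
  have hcardα : (1 : ℝ) < Fintype.card α := by
    exact_mod_cast Fintype.one_lt_card_iff_nontrivial.mpr ⟨⟨a₀, a₁, hα⟩⟩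
  have hcardβ : (1 : ℝ) < Fintype.card β := by
    exact_mod_cast Fintype.one_lt_card_iff_nontrivial.mpr ⟨⟨b₀, b₁, hβ⟩⟩
  have hp0 : 0 < p := by rw [hp]; linarith
  have hq0 : 0 < q := by rw [hq]; linarith
  have hG : G.Connected := rook_connected hadj
  have hVT : IsVertexTransitive G := rook_isVertexTransitive hadj
  have hreg := isRegularOfDegree_of_isVertexTransitive hVT (a₀, b₀)
  have hfixχ : ∀ π : α × β ≃ α × β, (∀ x y, G.Adj (π x) (π y) ↔ G.Adj x y) →
      ∀ σ, χ (σ ∘ π) = χ σ :=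
    fun π hπ σ => congrFun (sectorGS_comp_eq_self G hG Δ _ π hπ hχK hχH) σ
  have hreal : ∀ σ, χ σ = (((χ σ).re : ℝ) : ℂ) := fun σ =>
    Complex.ext (by rw [Complex.ofReal_re]) (by rw [Complex.ofReal_im]; exact (hχnn σ).2)
  -- the three class values
  set a : ℝ := (χ (Pi.single (a₀, b₀) 1 + Pi.single (a₁, b₀) 1)).re with hadef
  set b : ℝ := (χ (Pi.single (a₀, b₀) 1 + Pi.single (a₀, b₁) 1)).re with hbdef
  set cc : ℝ := (χ (Pi.single (a₀, b₀) 1 + Pi.single (a₁, b₁) 1)).re with hccdef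
  have hA : ∀ x y : α × β, x.1 ≠ y.1 → x.2 = y.2 →
      χ (Pi.single x 1 + Pi.single y 1) = (a : ℂ) := by
    intro x y h1 h2
    rw [rowPair_eq hadj hfixχ h1 h2 (i' := (a₀, b₀)) (j' := (a₁, b₀)) hα rfl]
    exact hreal _
  have hB : ∀ x y : α × β, x.1 = y.1 → x.2 ≠ y.2 →
      χ (Pi.single x 1 + Pi.single y 1) = (b : ℂ) := by
    intro x y h1 h2
    rw [colPair_eq hadj hfixχ h1 h2 (i' := (a₀, b₀)) (j' := (a₀, b₁)) rfl hβ]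
    exact hreal _
  have hC : ∀ x y : α × β, x.1 ≠ y.1 → x.2 ≠ y.2 →
      χ (Pi.single x 1 + Pi.single y 1) = (cc : ℂ) := by
    intro x y h1 h2
    rw [farPair_eq hadj hfixχ h1 h2 (i' := (a₀, b₀)) (j' := (a₁, b₁)) hα hβ]
    exact hreal _
  have ha0 : 0 ≤ a := (hχnn _).1
  have hb0 : 0 ≤ b := (hχnn _).1
  have hc0 : 0 ≤ cc := (hχnn _).1
  -- the `3 × 3` system
  obtain ⟨h1, h2, h3⟩ := rook_eigen_relations hadj hreg hα hβ hA hB hC hχH p q hp hq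
  -- `c > 0`: otherwise `χ = 0`
  have hsuppχ := apply_eq_zero_of_mem_twoMagnonSector hχK
  have hcpos : 0 < cc := by
    rcases hc0.lt_or_eq with h | h
    · exact h
    exfalso
    apply hχ0
    have hab : a + b = 0 := by
      rw [← h] at h3
      linarith
    have ha' : a = 0 := by linarith
    have hb' : b = 0 := by linarith
    funext σ
    by_cases hσ : (∑ z, (σ z : ℕ)) = 2
    · obtain ⟨i, j, hij, rfl⟩ := eq_pair_of_weight_eq_two hσ
      by_cases hi1 : i.1 = j.1
      · have hi2 : i.2 ≠ j.2 := fun h2 => hij (Prod.ext hi1 h2)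
        rw [hB i j hi1 hi2, hb', Complex.ofReal_zero, Pi.zero_apply]
      · by_cases hi2 : i.2 = j.2
        · rw [hA i j hi1 hi2, ha', Complex.ofReal_zero, Pi.zero_apply]
        · rw [hC i j hi1 hi2, ← h, Complex.ofReal_zero, Pi.zero_apply]
    · rw [hsuppχ σ hσ, Pi.zero_apply]
  obtain ⟨t, ht0, e1, e2, hσ⟩ := rook_t_param hp0 hq0 ha0 hb0 hcpos hΔ h1 h2 h3
  exact ⟨a, b, cc, t, ha0, hb0, hcpos, ht0, hA, hB, hC, e1, e2, hσ⟩

/-- **Flat overlap and norm of a class-constant two-magnon vector on the rook graph**: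
`⟨φ, χ⟩ = (N/2)(p a + q b + p q c)` and `‖χ‖² = (N/2)(p a² + q b² + p q c²)` (real values
`a, b, c` on row, column, far pairs; `p = |α| − 1`, `q = |β| − 1`, `N = |α||β|`). [folklore] -/
theorem rook_flat_norm {φ : (α × β → Fin 2) → ℂ}
    (hφ : ∀ σ, φ σ = if (∑ z, (σ z : ℕ)) = 2 then 1 else 0) {χ : (α × β → Fin 2) → ℂ}
    (hχK : χ ∈ spinZSector (Λ := α × β) 1 ((Fintype.card (α × β) : ℝ) / 2 - 2)) {a b cc : ℝ}
    (hA : ∀ x y : α × β, x.1 ≠ y.1 → x.2 = y.2 → χ (Pi.single x 1 + Pi.single y 1) = (a : ℂ))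
    (hB : ∀ x y : α × β, x.1 = y.1 → x.2 ≠ y.2 → χ (Pi.single x 1 + Pi.single y 1) = (b : ℂ))
    (hC : ∀ x y : α × β, x.1 ≠ y.1 → x.2 ≠ y.2 → χ (Pi.single x 1 + Pi.single y 1) = (cc : ℂ))
    (p q : ℝ) (hp : p = (Fintype.card α : ℝ) - 1) (hq : q = (Fintype.card β : ℝ) - 1) :
    star φ ⬝ᵥ χ = (((Fintype.card (α × β) : ℝ) / 2 * (p * a + q * b + p * q * cc) : ℝ) : ℂ) ∧
    (star χ ⬝ᵥ χ).re = (Fintype.card (α × β) : ℝ) / 2 * (p * a ^ 2 + q * b ^ 2 + p * q * cc ^ 2) := by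
  have hsuppχ := apply_eq_zero_of_mem_twoMagnonSector hχK
  constructor
  · rw [star_flat_dotProduct hφ hsuppχ]
    have h2 := (two_smul_sum_eq_sum_pairs χ hsuppχ).trans
      (sum_pairs_of_classes (fun i j => χ (Pi.single i 1 + Pi.single j 1)) hA hB hC)
    rw [two_smul] at h2
    have hs : (∑ σ, χ σ) = ((Fintype.card α : ℂ) * (Fintype.card β : ℂ) *
        (((Fintype.card α : ℂ) - 1) * (a : ℂ) + ((Fintype.card β : ℂ) - 1) * (b : ℂ)
          + ((Fintype.card α : ℂ) - 1) * ((Fintype.card β : ℂ) - 1) * (cc : ℂ))) / 2 := by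
      rw [eq_div_iff (two_ne_zero : (2 : ℂ) ≠ 0)]
      linear_combination h2
    rw [hs, hp, hq, Fintype.card_prod]
    push_cast
    ring
  · have h2 := (two_mul_norm_sq (ψ := χ) hsuppχ).trans (sum_pairs_of_classes_real
      (fun i j => (χ (Pi.single i 1 + Pi.single j 1)).re ^ 2 + (χ (Pi.single i 1 + Pi.single j 1)).im ^ 2)
      (a := a ^ 2) (b := b ^ 2) (c := cc ^ 2)
      (fun x y hx hy => by simp only [hA x y hx hy, Complex.ofReal_re, Complex.ofReal_im]; ring)
      (fun x y hx hy => by simp only [hB x y hx hy, Complex.ofReal_re, Complex.ofReal_im]; ring)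
      (fun x y hx hy => by simp only [hC x y hx hy, Complex.ofReal_re, Complex.ofReal_im]; ring))
    rw [hp, hq, Fintype.card_prod]
    push_cast at h2 ⊢
    linarith

/-- **The squared flat overlap of a two-magnon sector ground state on the rook graph** is
`(N/2)·p q·Nu(t)²/De(t)` at the parameter `t ≥ 0` determined by `1 − Δ = t(1 + 1/(p+t) + 1/(q+t))`
(`p = |α| − 1`, `q = |β| − 1`, `N = |α||β|`, `Δ ≤ 1`). [folklore] -/
theorem rook_flatOverlap_sq (G : SimpleGraph (α × β)) [DecidableRel G.Adj]
    (hadj : ∀ x y : α × β, G.Adj x y ↔ (x.1 ≠ y.1 ∧ x.2 = y.2) ∨ (x.1 = y.1 ∧ x.2 ≠ y.2))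
    {a₀ a₁ : α} (hα : a₀ ≠ a₁) {b₀ b₁ : β} (hβ : b₀ ≠ b₁)
    {φ : (α × β → Fin 2) → ℂ} (hφ : ∀ σ, φ σ = if (∑ z, (σ z : ℕ)) = 2 then 1 else 0)
    {Δ : ℝ} (hΔ : Δ ≤ 1) {ψ : (α × β → Fin 2) → ℂ}
    (gm : ψ ∈ spinZSector (Λ := α × β) 1 ((Fintype.card (α × β) : ℝ) / 2 - 2))
    (gn : star ψ ⬝ᵥ ψ = 1)
    (ge : xxzHamiltonian 1 G (-1) Δ *ᵥ ψ =
      ((lowestEnergyInSector 1 (xxzHamiltonian 1 G (-1) Δ) ((Fintype.card (α × β) : ℝ) / 2 - 2) : ℝ) : ℂ) • ψ)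
    (p q : ℝ) (hp : p = (Fintype.card α : ℝ) - 1) (hq : q = (Fintype.card β : ℝ) - 1) :
    ∃ t : ℝ, 0 ≤ t ∧ 1 - Δ = t * (1 + 1 / (p + t) + 1 / (q + t)) ∧
      ‖star φ ⬝ᵥ ψ‖ ^ 2 = (Fintype.card (α × β) : ℝ) / 2 *
        (p * q * (((p + t) * (q + t) + (p + t) + (q + t)) ^ 2 /
          ((p + t) ^ 2 * (q + t) ^ 2 + p * (q + t) ^ 2 + q * (p + t) ^ 2))) := by
  haveI : Nonempty α := ⟨a₀⟩
  haveI : Nonempty β := ⟨b₀⟩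
  have hcardα : (1 : ℝ) < Fintype.card α := by
    exact_mod_cast Fintype.one_lt_card_iff_nontrivial.mpr ⟨⟨a₀, a₁, hα⟩⟩
  have hcardβ : (1 : ℝ) < Fintype.card β := by
    exact_mod_cast Fintype.one_lt_card_iff_nontrivial.mpr ⟨⟨b₀, b₁, hβ⟩⟩
  have hp0 : 0 < p := by rw [hp]; linarith
  have hq0 : 0 < q := by rw [hq]; linarith
  have hG : G.Connected := rook_connected hadj
  have hrow : ((a₀, b₀) : α × β) ≠ (a₁, b₀) := fun h => hα (congrArg Prod.fst h)
  -- Perron–Frobenius: a nonnegative real sector ground vector `χ`, and `ψ = c • χ`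
  have hW : ∃ σ : TensorIndex (α × β) 2, (∑ z, (σ z : ℕ)) = 2 := ⟨_, weight_pair hrow⟩
  obtain ⟨⟨χ, hχK, hχ0, hχnn, hχH⟩, -⟩ := xxz_sector_perronFrobenius G hG Δ 2 hW
  have hM : ((Fintype.card (α × β) * 1 : ℕ) : ℝ) / 2 - ((2 : ℕ) : ℝ) =
      (Fintype.card (α × β) : ℝ) / 2 - 2 := by push_cast; ring
  rw [hM] at hχK hχH
  obtain ⟨c, hc⟩ := sectorGS_smul_of_sectorGS G hG Δ _ hχK hχ0 hχH gm ge
  obtain ⟨a, b, cc, t, ha0, hb0, hcpos, ht0, hA, hB, hC, e1, e2, hσ⟩ :=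
    rook_positive_solution G hadj hα hβ hΔ hχK hχ0 hχnn hχH p q hp hq
  refine ⟨t, ht0, hσ, ?_⟩
  obtain ⟨hflat, hnorm⟩ := rook_flat_norm hφ hχK hA hB hC p q hp hq
  -- transfer to `ψ = c • χ`
  have hNpos : (0 : ℝ) < Fintype.card (α × β) := by
    have : 0 < Fintype.card (α × β) := Fintype.card_pos
    exact_mod_cast this
  set m₁ : ℝ := p * a + q * b + p * q * cc with hm₁
  set m₂ : ℝ := p * a ^ 2 + q * b ^ 2 + p * q * cc ^ 2 with hm₂
  set Nu : ℝ := (p + t) * (q + t) + (p + t) + (q + t) with hNu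
  set De : ℝ := (p + t) ^ 2 * (q + t) ^ 2 + p * (q + t) ^ 2 + q * (p + t) ^ 2 with hDe
  have hm₂pos : 0 < m₂ := by
    have : 0 < p * q * cc ^ 2 := by positivity
    have h1' : 0 ≤ p * a ^ 2 := by positivity
    have h2' : 0 ≤ q * b ^ 2 := by positivity
    rw [hm₂]; linarith
  have hcn : ‖c‖ ^ 2 * (star χ ⬝ᵥ χ).re = 1 := by
    have h := gn
    rw [hc, star_smul, smul_dotProduct, dotProduct_smul, star_dotProduct_self_eq_re χ, smul_eq_mul,
      smul_eq_mul, Complex.star_def, ← mul_assoc, Complex.conj_mul', ← Complex.ofReal_pow,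
      ← Complex.ofReal_mul] at h
    exact_mod_cast h
  have hov : ‖star φ ⬝ᵥ ψ‖ ^ 2 = ‖c‖ ^ 2 * ((Fintype.card (α × β) : ℝ) / 2 * m₁) ^ 2 := by
    rw [hc, dotProduct_smul, smul_eq_mul, norm_mul, mul_pow, hflat, Complex.norm_real,
      Real.norm_eq_abs, sq_abs]
  -- the algebra of the exact solution
  have hqt : q + t ≠ 0 := by intro h0; rw [h0, zero_mul] at e1; nlinarith
  have hpt : p + t ≠ 0 := by intro h0; rw [h0, zero_mul] at e2; nlinarith
  have ha' : a = q * cc / (q + t) := by rw [eq_div_iff hqt]; linear_combination e1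
  have hb' : b = p * cc / (p + t) := by rw [eq_div_iff hpt]; linear_combination e2
  have hDepos : 0 < De := by rw [hDe]; positivity
  have key : m₁ ^ 2 * De = p * q * Nu ^ 2 * m₂ := by
    rw [hm₁, hm₂, hNu, hDe, ha', hb']
    field_simp
    ring
  have hX : m₁ ^ 2 / m₂ = p * q * (Nu ^ 2 / De) := by
    rw [div_eq_iff hm₂pos.ne', show p * q * (Nu ^ 2 / De) * m₂ = (p * q * Nu ^ 2 * m₂) / De by ring,
      eq_div_iff hDepos.ne']
    exact key
  -- conclude
  have hc2 : ‖c‖ ^ 2 = 1 / ((Fintype.card (α × β) : ℝ) / 2 * m₂) := by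
    rw [hnorm] at hcn
    rw [eq_div_iff (by positivity)]
    linarith
  rw [hov, hc2, ← hX]
  have hN2 : (Fintype.card (α × β) : ℝ) / 2 ≠ 0 := by positivity
  field_simp

/-- **The two-magnon rung TM-VT of `U_vt` on the rook graph `K_{|α|} □ K_{|β|}`** (see the module
docstring): in the sector `S^z_tot = |V|/2 − 2`, for `Δ₁ ≤ Δ₂ ≤ 1` and normalised sector ground
states, `Λ(ψ₁) ≤ Λ(ψ₂)` — two contact orbits, no lower bound on `Δ₁`. Tasaki (2020) §2.4, App. A;
theory seat `hubbard-h0-rotor-theory-1` cycle 5 (rook family). [folklore] -/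
theorem rook_twoMagnon_condensate_monotone (G : SimpleGraph (α × β)) [DecidableRel G.Adj]
    (hadj : ∀ x y : α × β, G.Adj x y ↔ (x.1 ≠ y.1 ∧ x.2 = y.2) ∨ (x.1 = y.1 ∧ x.2 ≠ y.2))
    (hα : 1 < Fintype.card α) (hβ : 1 < Fintype.card β)
    {Δ₁ Δ₂ : ℝ} (h12 : Δ₁ ≤ Δ₂) (h2 : Δ₂ ≤ 1) {ψ₁ ψ₂ : (α × β → Fin 2) → ℂ}
    (g₁m : ψ₁ ∈ spinZSector (Λ := α × β) 1 ((Fintype.card (α × β) : ℝ) / 2 - 2))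
    (g₁n : star ψ₁ ⬝ᵥ ψ₁ = 1)
    (g₁e : xxzHamiltonian 1 G (-1) Δ₁ *ᵥ ψ₁ =
      ((lowestEnergyInSector 1 (xxzHamiltonian 1 G (-1) Δ₁) ((Fintype.card (α × β) : ℝ) / 2 - 2) : ℝ) : ℂ) • ψ₁)
    (g₂m : ψ₂ ∈ spinZSector (Λ := α × β) 1 ((Fintype.card (α × β) : ℝ) / 2 - 2))
    (g₂n : star ψ₂ ⬝ᵥ ψ₂ = 1)
    (g₂e : xxzHamiltonian 1 G (-1) Δ₂ *ᵥ ψ₂ =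
      ((lowestEnergyInSector 1 (xxzHamiltonian 1 G (-1) Δ₂) ((Fintype.card (α × β) : ℝ) / 2 - 2) : ℝ) : ℂ) • ψ₂) :
    (star ψ₁ ⬝ᵥ (((∑ x, onSite x (spinRaise 1)) * (∑ y, onSite y (spinLower 1)) : Op (α × β) 2) *ᵥ ψ₁)).re ≤
      (star ψ₂ ⬝ᵥ (((∑ x, onSite x (spinRaise 1)) * (∑ y, onSite y (spinLower 1)) : Op (α × β) 2) *ᵥ ψ₂)).re := by
  obtain ⟨a₀, a₁, hα'⟩ := Fintype.one_lt_card_iff.mp hα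
  obtain ⟨b₀, b₁, hβ'⟩ := Fintype.one_lt_card_iff.mp hβ
  haveI : Nonempty α := ⟨a₀⟩
  haveI : Nonempty β := ⟨b₀⟩
  have hG : G.Connected := rook_connected hadj
  have hVT : IsVertexTransitive G := rook_isVertexTransitive hadj
  set φ : (α × β → Fin 2) → ℂ := fun σ => if (∑ z, (σ z : ℕ)) = 2 then 1 else 0 with hφdef
  have hφ : ∀ σ, φ σ = if (∑ z, (σ z : ℕ)) = 2 then 1 else 0 := fun σ => rfl
  have hfix₁ : ∀ π : α × β ≃ α × β, (∀ x y, G.Adj (π x) (π y) ↔ G.Adj x y) → ∀ σ, ψ₁ (σ ∘ π) = ψ₁ σ :=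
    fun π hπ σ => congrFun (sectorGS_comp_eq_self G hG Δ₁ _ π hπ g₁m g₁e) σ
  have hfix₂ : ∀ π : α × β ≃ α × β, (∀ x y, G.Adj (π x) (π y) ↔ G.Adj x y) → ∀ σ, ψ₂ (σ ∘ π) = ψ₂ σ :=
    fun π hπ σ => congrFun (sectorGS_comp_eq_self G hG Δ₂ _ π hπ g₂m g₂e) σ
  rw [condensate_eq_flatOverlap G hVT (a₀, b₀) hφ g₁m hfix₁,
    condensate_eq_flatOverlap G hVT (a₀, b₀) hφ g₂m hfix₂, g₁n, g₂n]
  have hn : (0 : ℝ) < Fintype.card (α × β) := by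
    have : 0 < Fintype.card (α × β) := Fintype.card_pos_iff.2 ⟨(a₀, b₀)⟩
    exact_mod_cast this
  suffices hkey : ‖star φ ⬝ᵥ ψ₁‖ ^ 2 ≤ ‖star φ ⬝ᵥ ψ₂‖ ^ 2 by
    have h4 : 0 ≤ 4 / (Fintype.card (α × β) : ℝ) := by positivity
    nlinarith [mul_le_mul_of_nonneg_left hkey h4]
  set p : ℝ := (Fintype.card α : ℝ) - 1 with hp
  set q : ℝ := (Fintype.card β : ℝ) - 1 with hq
  have hp0 : 0 < p := by
    have : (1 : ℝ) < Fintype.card α := by exact_mod_cast hα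
    rw [hp]; linarith
  have hq0 : 0 < q := by
    have : (1 : ℝ) < Fintype.card β := by exact_mod_cast hβ
    rw [hq]; linarith
  obtain ⟨t₁, ht₁, hσ₁, hov₁⟩ :=
    rook_flatOverlap_sq G hadj hα' hβ' hφ (le_trans h12 h2) g₁m g₁n g₁e p q hp hq
  obtain ⟨t₂, ht₂, hσ₂, hov₂⟩ := rook_flatOverlap_sq G hadj hα' hβ' hφ h2 g₂m g₂n g₂e p q hp hq
  rw [hov₁, hov₂]
  have h21 : t₂ ≤ t₁ := rook_le_of_sigma_le hp0 hq0 ht₁ (by rw [← hσ₁, ← hσ₂]; linarith)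
  have hle := rookOverlap_le hp0 hq0 ht₂ h21
  exact mul_le_mul_of_nonneg_left hle (by positivity)

/-- **The rung `TwoMagnonVTCondensateMonotone` of `…SpinMonotoneDefs` on the rook graphs**
(its statement verbatim for `V = α × β`, with the graph hypothesis "`G` is the rook graph" and
`|α|, |β| ≥ 2` in place of connectedness + vertex-transitivity, which they imply): for
`−1 ≤ Δ₁ ≤ Δ₂ ≤ 1` the two-magnon condensate of normalised sector ground states is non-decreasing
from `Δ₁` to `Δ₂`. [folklore] -/
theorem twoMagnonVT_of_rook :
    ∀ (α β : Type) [Fintype α] [DecidableEq α] [Fintype β] [DecidableEq β]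
      (G : SimpleGraph (α × β)) [DecidableRel G.Adj],
      (∀ x y : α × β, G.Adj x y ↔ (x.1 ≠ y.1 ∧ x.2 = y.2) ∨ (x.1 = y.1 ∧ x.2 ≠ y.2)) →
      1 < Fintype.card α → 1 < Fintype.card β →
      ∀ (Δ₁ Δ₂ : ℝ), -1 ≤ Δ₁ → Δ₁ ≤ Δ₂ → Δ₂ ≤ 1 →
      ∀ ψ₁ ψ₂ : TensorIndex (α × β) 2 → ℂ,
        ψ₁ ∈ spinZSector (Λ := α × β) 1 ((Fintype.card (α × β) : ℝ) / 2 - 2) → star ψ₁ ⬝ᵥ ψ₁ = 1 →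
        xxzHamiltonian 1 G (-1) Δ₁ *ᵥ ψ₁ =
          ((lowestEnergyInSector 1 (xxzHamiltonian 1 G (-1) Δ₁) ((Fintype.card (α × β) : ℝ) / 2 - 2) : ℝ) : ℂ) • ψ₁ →
        ψ₂ ∈ spinZSector (Λ := α × β) 1 ((Fintype.card (α × β) : ℝ) / 2 - 2) → star ψ₂ ⬝ᵥ ψ₂ = 1 →
        xxzHamiltonian 1 G (-1) Δ₂ *ᵥ ψ₂ =
          ((lowestEnergyInSector 1 (xxzHamiltonian 1 G (-1) Δ₂) ((Fintype.card (α × β) : ℝ) / 2 - 2) : ℝ) : ℂ) • ψ₂ →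
        (star ψ₁ ⬝ᵥ (((∑ x, onSite x (spinRaise 1)) * (∑ y, onSite y (spinLower 1)) : Op (α × β) 2) *ᵥ ψ₁)).re
          ≤ (star ψ₂ ⬝ᵥ (((∑ x, onSite x (spinRaise 1)) * (∑ y, onSite y (spinLower 1)) : Op (α × β) 2) *ᵥ ψ₂)).re :=
  fun _ _ _ _ _ _ G _ hadj hα hβ _ _ _ h12 h2 _ _ g₁m g₁n g₁e g₂m g₂n g₂e =>
    rook_twoMagnon_condensate_monotone G hadj hα hβ h12 h2 g₁m g₁n g₁e g₂m g₂n g₂e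

/-- **Mathlib form: the two-magnon rung on `⊤ □ ⊤`** (`K_{|α|} □ K_{|β|}` as the box product of two
complete graphs, any decidability instance), `|α|, |β| ≥ 2`, all `Δ₁ ≤ Δ₂ ≤ 1`. [folklore] -/
theorem boxProdTop_twoMagnon_condensate_monotone
    [DecidableRel ((⊤ : SimpleGraph α) □ (⊤ : SimpleGraph β)).Adj]
    (hα : 1 < Fintype.card α) (hβ : 1 < Fintype.card β)
    {Δ₁ Δ₂ : ℝ} (h12 : Δ₁ ≤ Δ₂) (h2 : Δ₂ ≤ 1) {ψ₁ ψ₂ : (α × β → Fin 2) → ℂ}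
    (g₁m : ψ₁ ∈ spinZSector (Λ := α × β) 1 ((Fintype.card (α × β) : ℝ) / 2 - 2))
    (g₁n : star ψ₁ ⬝ᵥ ψ₁ = 1)
    (g₁e : xxzHamiltonian 1 ((⊤ : SimpleGraph α) □ (⊤ : SimpleGraph β)) (-1) Δ₁ *ᵥ ψ₁ =
      ((lowestEnergyInSector 1 (xxzHamiltonian 1 ((⊤ : SimpleGraph α) □ (⊤ : SimpleGraph β)) (-1) Δ₁)
        ((Fintype.card (α × β) : ℝ) / 2 - 2) : ℝ) : ℂ) • ψ₁)
    (g₂m : ψ₂ ∈ spinZSector (Λ := α × β) 1 ((Fintype.card (α × β) : ℝ) / 2 - 2))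
    (g₂n : star ψ₂ ⬝ᵥ ψ₂ = 1)
    (g₂e : xxzHamiltonian 1 ((⊤ : SimpleGraph α) □ (⊤ : SimpleGraph β)) (-1) Δ₂ *ᵥ ψ₂ =
      ((lowestEnergyInSector 1 (xxzHamiltonian 1 ((⊤ : SimpleGraph α) □ (⊤ : SimpleGraph β)) (-1) Δ₂)
        ((Fintype.card (α × β) : ℝ) / 2 - 2) : ℝ) : ℂ) • ψ₂) :
    (star ψ₁ ⬝ᵥ (((∑ x, onSite x (spinRaise 1)) * (∑ y, onSite y (spinLower 1)) : Op (α × β) 2) *ᵥ ψ₁)).re ≤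
      (star ψ₂ ⬝ᵥ (((∑ x, onSite x (spinRaise 1)) * (∑ y, onSite y (spinLower 1)) : Op (α × β) 2) *ᵥ ψ₂)).re := by
  refine rook_twoMagnon_condensate_monotone _ (fun x y => ?_) hα hβ h12 h2 g₁m g₁n g₁e g₂m g₂n g₂e
  rw [SimpleGraph.boxProd_adj, SimpleGraph.top_adj, SimpleGraph.top_adj]
  tauto

end Summit.HubbardSuperconductivity.HubbardSuperconductivity.Theorems.AnisotropyChord.TwoMagnon
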